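/-
Origin: expansion seat `prover-pub-hodgecm-mc-binder-2-g11-0`, handover #33 2026-08-20T02:20Z md5 392a86915ae1 (238 l.; CERTIFIED rc 0 / 0 warn / 19.4 s; imports #32 + RUN-37 #25 `TorusChart` + PKG `PerL34/NormOneRelTorusWeights` + twins `SegalBargmann/FockInvariantLines`, `Automorphic/AdelicGLnGlue`; §0 `scaleConj_diagonal`, `circleRestrict`, `coe_kV_diagHom_restrict`; §1 **`torusPlaceCircles v : T(L⁺⊗ℝ) →* (Fin 2 → Circle)`** (`j ↦ archPlaceChar w(v) u_j`), **`torusPlaceLetter v : T(L⁺⊗ℝ) →* DPK …`** `= ((1,1),(diagHom c∣R_v, diagHom c∣S_v))`; §2 `continuous_archDiagHom`, `torusPairHom := (1, archDiagHom)`, `coe_archAt_archDiag`, `fst/snd_cmPlaceComponent` (rfl), **`cmPlaceComponent_torusPairHom`** (E's chart point has compact-letter components at every place); §3 **`exists_character_cmArchWeilRep_torus`** (χ_T); NAME LIST `HodgeCM.Model.HypCensus.cmPlaceComponent_torusPairHom`, `HodgeCM.Model.HypCensus.exists_character_cmArchWeilRep_torus`, `HodgeCM.Model.HypCensus.torusPlaceLetter`;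 axioms trio) (`HOME/mc/pub-hodgecm-mc-binder-2/g11/pkg/HodgeCM/Model/HypCensus/TorusLetters.lean`, md5 392a86915ae1, 238 lines);
landed by the gen-14 packager (p-g14) in gate run 39 as `HodgeCM/Model/HypCensus/TorusLetters.lean` (verbatim).
-/
/-
Origin: speedrun cell pub-hodgecm, MODEL-CONSTRUCTION sub-cell, lineage mc-binder-2 (BINDER-OWNERS rows 18/19: E binders
`hyp12` / `hyp34` of `Model.perL_picardCM_r15A`), seat prover-pub-hodgecm-mc-binder-2-g11-0 (gen 11), 2026-08-20.
Target in PKG: `HodgeCM/Model/HypCensus/TorusLetters.lean` (NEW additive leaf; imports this lineage's `HypCensus/CompactLetters`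
(gen 11), the RUN-37 INSTALLED `HypCensus/TorusChart` (#25), PKG `PerL34/NormOneRelTorusWeights` and the PKG-present twins
`Analysis/SegalBargmann/FockInvariantLines`, `NumberTheory/Automorphic/AdelicGLnGlue`).
KERNEL ONLY: 0 records, nothing cited as hypothesis, 0 `def … : Prop`; two data defs (monoid homs) + theorems.
-/
import Summits.HodgeConjecture.HodgeCM.Model.HypCensus.CompactLetters
import Summits.HodgeConjecture.HodgeCM.Model.HypCensus.TorusChart
import Summits.HodgeConjecture.HodgeCM.PerL34.NormOneRelTorusWeights
import Literature.Analysis.SegalBargmann.FockInvariantLines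
import Literature.NumberTheory.Automorphic.AdelicGLnGlue

/-!
# Census kit (rows A12/A34), junction (J-T12): the archimedean torus element IS a family of compact letters

`HypCensus/TorusChart` (#25) reads E's chart point on the W pin of record as the adelic image of the ARCHIMEDEAN pair element
`(1, archDiag (dW S) u)`, `u ∈ T(L⁺ ⊗ ℝ)`.  This leaf computes its PLACE COMPONENTS in the canonical block frames of the pin
(`CompactLetters.cmPlaceComponent`): at every real place `v` of `L⁺` the component is the COMPACT LETTER
`κ ((1,1), (diag_{R_v} c, diag_{S_v} c))`, `c_j = ι_{w(v)}(u_j) ∈ S¹` the circle coordinates of `u` at the complex place `w(v)`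
over `v` (pv11 `archPlaceChar`), sorted into the `W`-blocks `R_v = PosIdx`, `S_v = NegIdx` of the sign frame — so the engine
`CompactLetters.exists_character_cmArchWeilRep_follandFock` applies to the torus:

* §1 `torusPlaceCircles v : T(L⁺ ⊗ ℝ) →* (Fin 2 → S¹)`, `torusPlaceLetter v : T(L⁺ ⊗ ℝ) →* K_{V,v} × K_{W,v}` (monoid homs);
* §2 `continuous_archDiagHom` (the torus element depends continuously on `u`), `torusPairHom := (1, archDiagHom)` and
  **`cmPlaceComponent_torusPairHom`**: `cmPlaceComponent v (1, archDiag (dW) u) = κ (torusPlaceLetter v u)`;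
* §3 **`exists_character_cmArchWeilRep_torus`** — ONE continuous character `χ_T : T(L⁺ ⊗ ℝ) →* S¹` with
  `ω_∞(1, archDiag u) (follandFock 𝔢 G) = χ_T u • follandFock 𝔢 (G ∘ (torus letter block)⁻¹)` for every Fock polynomial `G`.

Nothing here is a claim of PerL/QW8.  Style lint (L-notation): no `local notation`.
-/

set_option autoImplicit false

noncomputable section

open NumberField NumberField.InfinitePlace IsDedekindDomain
open scoped Matrix Kronecker Classical TensorProduct ComplexConjugate
open MvPolynomial
open Literature.NumberTheory.Automorphic Literature.NumberTheory.Automorphic.UnitaryGroup Literature.NumberTheory.Weil1964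
open Literature.RepresentationTheory.HeisenbergGroup (polar symplecticGroup)
open Literature.RepresentationTheory.KonnoKonno2007 Literature.RepresentationTheory.KonnoKonno2007.RealDualPair
open Literature.NumberTheory.GelbartRogawski1991 Literature.NumberTheory.GelbartRogawski1991.UnitaryDualPair
open Literature.Analysis.SegalBargmann
open HodgeCM.PerL34.DiagonalTorus

namespace HodgeCM.Model.HypCensus

/-! ## §0 (generic) diagonal letters in a sign frame -/

section Generic

variable {n : Type*}

/-- conjugation by a real diagonal scaling fixes a diagonal matrix. [folklore] -/
theorem scaleConj_diagonal [DecidableEq n] (D : n → ℝ) (hD0 : ∀ j, D j ≠ 0) (c : n → ℂ) :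
    scaleConj D (Matrix.diagonal c) = Matrix.diagonal c := by
  ext i j
  rw [scaleConj_apply, Matrix.diagonal_apply]
  split_ifs with h
  · subst h
    rw [mul_comm ((D i : ℂ)) (c i), mul_assoc, mul_inv_cancel₀ (Complex.ofReal_ne_zero.2 (hD0 i)), mul_one]
  · rw [mul_zero, zero_mul]

/-- restriction of a circle family to a subtype of indices, as a monoid hom. -/
def circleRestrict (p : n → Prop) : (n → Circle) →* ({i : n // p i} → Circle) :=
  MonoidHom.pi fun i => Pi.evalMonoidHom (fun _ : n => Circle) i.1

/-- (Ported verbatim from the HodgeCMPerL package; no docstring in the source.) -/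
@[simp] theorem circleRestrict_apply (p : n → Prop) (c : n → Circle) (i : {i : n // p i}) :
    circleRestrict p c i = c i.1 := rfl

/-- **the diagonal letter `diag(c)` sorted into the blocks of a sign frame**: the matrix of
`kV (diag c|_P, diag c|_Q)` in the frame `Equiv.sumCompl p` is `diagonal c` reindexed. -/
theorem coe_kV_diagHom_restrict [Fintype n] [DecidableEq n] (p : n → Prop) [DecidablePred p] (c : n → Circle) :
    (((UForm.kV {i // p i} {i // ¬p i} (diagHom (circleRestrict p c), diagHom (circleRestrict (fun i => ¬p i) c)) :
        UForm {i // p i} {i // ¬p i}) : GL ({i // p i} ⊕ {i // ¬p i}) ℂ) :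
          Matrix ({i // p i} ⊕ {i // ¬p i}) ({i // p i} ⊕ {i // ¬p i}) ℂ) =
      Matrix.reindex (Equiv.sumCompl p).symm (Equiv.sumCompl p).symm (Matrix.diagonal fun i => ((c i : Circle) : ℂ)) := by
  rw [UForm.coe_kV, coe_diagHom, coe_diagHom, Matrix.fromBlocks_diagonal, Matrix.reindex_apply, Equiv.symm_symm,
    Matrix.submatrix_diagonal_equiv]
  congr 1
  funext x
  rcases x with x | x <;> rfl

end Generic

/-! ## §1 The letters of the torus at a real place -/

section Torus

variable (L : Type) [Field L] [NumberField L] [IsCMField L] {N n : ℕ} (e : Fin N × Fin 2 ≃ Fin n)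
variable (dV : Fin N → L) (hdV : ∀ i, IsCMField.complexConj L (dV i) = dV i) (hdV0 : ∀ i, dV i ≠ 0)
variable (dW : Fin 2 → L) (hdW : ∀ i, IsCMField.complexConj L (dW i) = dW i) (hdW0 : ∀ i, dW i ≠ 0)
variable (hGR : (cmSplittingDatum L e dV hdV hdV0 dW hdW hdW0).CompatibleSplitting) (ι₁ : L →+* ℂ)

/-- **the circle coordinates of `u ∈ T(L⁺ ⊗ ℝ)` at the complex place `w(v)` over the real place `v`**:
`j ↦ ι_{w(v)}(u_j)`, `u = (u₀, u₁)`. -/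
def torusPlaceCircles (v : {v : InfinitePlace ↥(maximalRealSubfield L) // v.IsReal}) :
    SeesawArchTorus L →* (Fin 2 → Circle) :=
  MonoidHom.pi ![(NumberField.archPlaceChar L (cmPlaceOver L v).1).comp (SeesawArchTorus.fst L),
    (NumberField.archPlaceChar L (cmPlaceOver L v).1).comp (SeesawArchTorus.snd L)]

/-- (Ported verbatim from the HodgeCMPerL package; no docstring in the source.) -/
theorem torusPlaceCircles_apply_zero (v : {v : InfinitePlace ↥(maximalRealSubfield L) // v.IsReal}) (u : SeesawArchTorus L) :
    torusPlaceCircles L v u 0 = NumberField.archPlaceChar L (cmPlaceOver L v).1 (SeesawArchTorus.fst L u) := rfl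

/-- (Ported verbatim from the HodgeCMPerL package; no docstring in the source.) -/
theorem torusPlaceCircles_apply_one (v : {v : InfinitePlace ↥(maximalRealSubfield L) // v.IsReal}) (u : SeesawArchTorus L) :
    torusPlaceCircles L v u 1 = NumberField.archPlaceChar L (cmPlaceOver L v).1 (SeesawArchTorus.snd L u) := rfl

/-- **the compact letter of the torus at `v`**: `((1,1), (diag_{R_v} c, diag_{S_v} c))`, `c = torusPlaceCircles v u`, the `W`-blocks
being the sign blocks `R_v = PosIdx x_W`, `S_v = NegIdx x_W` of the canonical frame. -/
def torusPlaceLetter (v : {v : InfinitePlace ↥(maximalRealSubfield L) // v.IsReal}) :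
    SeesawArchTorus L →* DPK (PosIdx (cmXV L dV hdV ι₁ v)) (NegIdx (cmXV L dV hdV ι₁ v)) (PosIdx (cmXW L dV dW hdW ι₁ v))
      (NegIdx (cmXW L dV dW hdW ι₁ v)) :=
  (MonoidHom.inr (Matrix.unitaryGroup (PosIdx (cmXV L dV hdV ι₁ v)) ℂ × Matrix.unitaryGroup (NegIdx (cmXV L dV hdV ι₁ v)) ℂ)
      (Matrix.unitaryGroup (PosIdx (cmXW L dV dW hdW ι₁ v)) ℂ × Matrix.unitaryGroup (NegIdx (cmXW L dV dW hdW ι₁ v)) ℂ)).comp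
    (((diagHom.comp (circleRestrict fun j => 0 < cmXW L dV dW hdW ι₁ v j)).prod
        (diagHom.comp (circleRestrict fun j => ¬0 < cmXW L dV dW hdW ι₁ v j))).comp
      (torusPlaceCircles L v))

/-- (Ported verbatim from the HodgeCMPerL package; no docstring in the source.) -/
theorem torusPlaceLetter_fst (v : {v : InfinitePlace ↥(maximalRealSubfield L) // v.IsReal}) (u : SeesawArchTorus L) :
    (torusPlaceLetter L dV hdV dW hdW ι₁ v u).1 = 1 := rfl

/-- (Ported verbatim from the HodgeCMPerL package; no docstring in the source.) -/
theorem torusPlaceLetter_snd (v : {v : InfinitePlace ↥(maximalRealSubfield L) // v.IsReal}) (u : SeesawArchTorus L) :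
    (torusPlaceLetter L dV hdV dW hdW ι₁ v u).2 =
      (diagHom (circleRestrict (fun j => 0 < cmXW L dV dW hdW ι₁ v j) (torusPlaceCircles L v u)),
        diagHom (circleRestrict (fun j => ¬0 < cmXW L dV dW hdW ι₁ v j) (torusPlaceCircles L v u))) := rfl

/-! ## §2 The torus element as a continuous hom and its place components -/

/-- `u ↦ diag(u₀, u₁) ∈ U(diag dW)(L⁺ ⊗ ℝ)` is continuous. -/
theorem continuous_archDiagHom : Continuous (archDiagHom L dW) := by
  refine Continuous.subtype_mk ?_ _
  change Continuous fun u => archDiagGL L u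
  unfold archDiagGL
  refine continuous_diagGL₂.comp (Continuous.prodMk ?_ ?_)
  · exact (Continuous.units_map _ (continuous_ringEquiv_mixedSpace L)).comp
      (continuous_subtype_val.comp continuous_fst)
  · exact (Continuous.units_map _ (continuous_ringEquiv_mixedSpace L)).comp
      (continuous_subtype_val.comp continuous_snd)

/-- **the torus in the archimedean pair group**: `u ↦ (1, diag(u₀, u₁))`. -/
def torusPairHom :
    SeesawArchTorus L →*
      UnitaryGroup.arch (↥(maximalRealSubfield L)) L (IsCMField.complexConj L) N (Matrix.diagonal dV) ×
        UnitaryGroup.arch (↥(maximalRealSubfield L)) L (IsCMField.complexConj L) 2 (Matrix.diagonal dW) :=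
  (1 : SeesawArchTorus L →* UnitaryGroup.arch (↥(maximalRealSubfield L)) L (IsCMField.complexConj L) N (Matrix.diagonal dV)).prod
    (archDiagHom L dW)

/-- (Ported verbatim from the HodgeCMPerL package; no docstring in the source.) -/
@[simp] theorem torusPairHom_apply (u : SeesawArchTorus L) : torusPairHom L dV dW u = (1, archDiag L dW u) := rfl

/-- (Ported verbatim from the HodgeCMPerL package; no docstring in the source.) -/
theorem continuous_torusPairHom : Continuous (torusPairHom L dV dW) :=
  continuous_const.prodMk (continuous_archDiagHom L dW)

/-- the local component of `diag(u₀, u₁)` at the complex place `w(v)` is `diag(ι_{w(v)} u₀, ι_{w(v)} u₁)`. -/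
theorem coe_archAt_archDiag (v : {v : InfinitePlace ↥(maximalRealSubfield L) // v.IsReal}) (u : SeesawArchTorus L) :
    (((archAt (↥(maximalRealSubfield L)) L (IsCMField.complexConj L) 2 (Matrix.diagonal dW) (cmPlaceOver L v)
        (cmPlaceOver_smul L v) (IsCMField.complexConj_ne_one L) (archDiag L dW u) :
          archLocal L 2 (Matrix.diagonal dW) (cmPlaceOver L v)) : GL (Fin 2) ℂ) : Matrix (Fin 2) (Fin 2) ℂ) =
      Matrix.diagonal fun j => ((torusPlaceCircles L v u j : Circle) : ℂ) := by
  ext i j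
  rw [coe_archAt_apply, coe_archDiag, val_archDiagGL, Matrix.diagonal_apply, Matrix.diagonal_apply]
  split_ifs with h
  · subst h
    fin_cases i <;> rfl
  · rfl

/-- the `V`-component of a place component (definitional). -/
theorem fst_cmPlaceComponent (v : {v : InfinitePlace ↥(maximalRealSubfield L) // v.IsReal})
    (x : UnitaryGroup.arch (↥(maximalRealSubfield L)) L (IsCMField.complexConj L) N (Matrix.diagonal dV))
    (y : UnitaryGroup.arch (↥(maximalRealSubfield L)) L (IsCMField.complexConj L) 2 (Matrix.diagonal dW)) :
    (cmPlaceComponent L dV hdV hdV0 dW hdW hdW0 ι₁ v (x, y)).1 =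
      archUForm L (IsCMField.complexConj L) N (IsCMField.complexConj_ne_one L) (cmPlaceOver L) (cmPlaceOver_smul L)
        (cmPlaceOver_comap L) (cmRealVec L dV hdV) (realDiagonal_map L dV hdV).symm v (cmEpsV L dV hdV ι₁ v)
        (cmDV_ne_zero L dV hdV hdV0 ι₁ v) (cmSignConv_ne_zero L dV ι₁ v) (cm_htV L dV hdV hdV0 ι₁ v)
        (archToAdelic (↥(maximalRealSubfield L)) L (IsCMField.complexConj L) N (Matrix.diagonal dV) x) := rfl

/-- the `W`-component of a place component (definitional). -/
theorem snd_cmPlaceComponent (v : {v : InfinitePlace ↥(maximalRealSubfield L) // v.IsReal})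
    (x : UnitaryGroup.arch (↥(maximalRealSubfield L)) L (IsCMField.complexConj L) N (Matrix.diagonal dV))
    (y : UnitaryGroup.arch (↥(maximalRealSubfield L)) L (IsCMField.complexConj L) 2 (Matrix.diagonal dW)) :
    (cmPlaceComponent L dV hdV hdV0 dW hdW hdW0 ι₁ v (x, y)).2 =
      archUForm L (IsCMField.complexConj L) 2 (IsCMField.complexConj_ne_one L) (cmPlaceOver L) (cmPlaceOver_smul L)
        (cmPlaceOver_comap L) (cmRealVec L dW hdW) (realDiagonal_map L dW hdW).symm v (cmEpsW L dV dW hdW ι₁ v)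
        (cmDW_ne_zero L dV dW hdW hdW0 ι₁ v) (cmCW_ne_zero L dV ι₁ v) (cm_htW L dV dW hdW hdW0 ι₁ v)
        (archToAdelic (↥(maximalRealSubfield L)) L (IsCMField.complexConj L) 2 (Matrix.diagonal dW) y) := rfl

/-- **the place components of the torus element are the torus letters**:
`cmPlaceComponent v (1, archDiag (dW) u) = κ (torusPlaceLetter v u)` at every real place `v`. -/
theorem cmPlaceComponent_torusPairHom (v : {v : InfinitePlace ↥(maximalRealSubfield L) // v.IsReal}) (u : SeesawArchTorus L) :
    cmPlaceComponent L dV hdV hdV0 dW hdW hdW0 ι₁ v (torusPairHom L dV dW u) =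
      κ _ _ _ _ (torusPlaceLetter L dV hdV dW hdW ι₁ v u) := by
  rw [torusPairHom_apply]
  refine Prod.ext ?_ ?_
  · -- the `V`-component: `1` on both sides
    rw [fst_cmPlaceComponent, map_one]
    refine (map_one _).trans ?_
    change (1 : UForm _ _) = UForm.kV _ _ (torusPlaceLetter L dV hdV dW hdW ι₁ v u).1
    rw [torusPlaceLetter_fst, map_one]
  · -- the `W`-component: a diagonal unitary, frame-conjugated and sign-sorted
    rw [snd_cmPlaceComponent]
    apply Subtype.ext
    apply Units.ext
    rw [coe_archUForm, archPart_archToAdelic, coe_archAt_archDiag, scaleConj_diagonal _ (cmDW_ne_zero L dV dW hdW hdW0 ι₁ v)]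
    exact (coe_kV_diagHom_restrict (fun j => 0 < cmXW L dV dW hdW ι₁ v j) (torusPlaceCircles L v u)).symm

/-! ## §3 One character for the torus -/

/-- **THE TORUS CHARACTER OF THE PIN.**  Under the sign facts of the pin there is ONE continuous character
`χ_T : T(L⁺ ⊗ ℝ) →* S¹` with `ω_∞(1, diag(u₀,u₁)) (follandFock 𝔢 G) = χ_T u • follandFock 𝔢 (G ∘ (torus letter block)⁻¹)` for every
Fock polynomial `G` of the big frame; the letter block is `placeBlock (v ↦ (dualPairι (torusPlaceLetter v u))^{pairFrame_v})`.
[Folland1989, Prop. (4.39); Weil1964, Chap. I n° 12] -/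
theorem exists_character_cmArchWeilRep_torus
    (h₁V : ∃ i₀ : Fin N, (∀ i, i ≠ i₀ → 0 < (ι₁ (dV i)).re) ∨ ∀ i, i ≠ i₀ → (ι₁ (dV i)).re < 0)
    (h₁W : (∀ j, 0 < (ι₁ (dW j)).re) ∨ ∀ j, (ι₁ (dW j)).re < 0)
    (hV : ∀ τ : L →+* ℂ, InfinitePlace.mk τ ≠ InfinitePlace.mk ι₁ →
      (∀ i, 0 < (τ (dV i)).re) ∨ ∀ i, (τ (dV i)).re < 0)
    (hW : ∀ τ : L →+* ℂ, InfinitePlace.mk τ ≠ InfinitePlace.mk ι₁ →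
      (∃ j₀ : Fin 2, ∀ j, j ≠ j₀ → 0 < (τ (dW j)).re) ∨ ∀ j, (τ (dW j)).re < 0) :
    ∃ χ : SeesawArchTorus L →* Circle, Continuous χ ∧
      ∀ (u : SeesawArchTorus L) (G : MvPolynomial (Fin n × {v : InfinitePlace ↥(maximalRealSubfield L) // v.IsReal}) ℂ),
        cmArchWeilRep L e dV hdV hdV0 dW hdW hdW0 hGR ((1 : UnitaryGroup.arch (↥(maximalRealSubfield L)) L
            (IsCMField.complexConj L) N (Matrix.diagonal dV)), archDiag L dW u)
            (follandFock (cmBigFrame L e dV hdV hdV0 dW hdW hdW0 ι₁) G) =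
          ((χ u : Circle) : ℂ) •
            follandFock (cmBigFrame L e dV hdV hdV0 dW hdW hdW0 ι₁)
              (linSubst (star ((cmLetterBlock L e dV hdV dW hdW ι₁ (torusPlaceLetter L dV hdV dW hdW ι₁) u :
                Matrix.unitaryGroup (Fin n × {v : InfinitePlace ↥(maximalRealSubfield L) // v.IsReal}) ℂ) :
                  Matrix _ _ ℂ)) G) :=
  exists_character_cmArchWeilRep_follandFock L e dV hdV hdV0 dW hdW hdW0 hGR ι₁ h₁V h₁W hV hW (torusPairHom L dV dW)
    (continuous_torusPairHom L dV dW) (torusPlaceLetter L dV hdV dW hdW ι₁)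
    (cmPlaceComponent_torusPairHom L dV hdV hdV0 dW hdW hdW0 ι₁)

end Torus

end HodgeCM.Model.HypCensus

end
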